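import Mathlib

/-!
# SoloBlind — lift-up gain identity on a closed leaf (PLATEAU, piece (PL-3′))

On a closed streamline of period `T` the five frame scalars of the Görtler chain are
`a₀ = -V̂·(∇V)V̂`, `b`, `c = -2 (JV̂)·(∇V)V̂`, `h ∝ |V| (p·JV̂)`, `hₓ ∝ |V| (p·V̂)`, where `p` is the
normalised Floquet vector of the strain cocycle, `ṗ = -(∇V)p - σ p`.  In the streamline frame the
components `πs = p·V̂`, `πn = p·JV̂` obey `π̇n = c πs - a₀ πn - σ πn`, and `hₓ/h = πs/πn`.
Hence the lift-up loop gain `c hₓ/h = π̇n/πn + a₀ + σ` has period average exactly `σ`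
(theorem `liftUpGain_integral`), and the closed-form limit slow rate
`α∞ = -a₀ - K₀ + c hₓ/(2h)` integrates to `(σ/2 - K₀) T` over a period
(theorem `slowRate_integral`), i.e. `-K₀ T/2` at the design point `K₀ = σ`
(theorem `slowRate_integral_design`).  Pure one-variable calculus: the ODE for `πn`,
non-vanishing and periodicity of `πn`, and `∫ a₀ = 0`.
-/

namespace Summit.AnomalousDissipation.AnomalousDissipation.Theorems

open intervalIntegral

/-- Lift-up gain identity: if `πn' = c πs - a₀ πn - σ πn` with `πn` non-vanishing and
`T`-periodic and `∫₀ᵀ a₀ = 0`, then `∫₀ᵀ c πs / πn = σ T`. -/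
theorem liftUpGain_integral (T σ : ℝ) (a₀ c πs πn : ℝ → ℝ)
    (ha : Continuous a₀) (hc : Continuous c) (hs : Continuous πs) (hn : Continuous πn)
    (hode : ∀ t, HasDerivAt πn (c t * πs t - a₀ t * πn t - σ * πn t) t)
    (hnz : ∀ t, πn t ≠ 0) (hper : πn T = πn 0)
    (hmean : ∫ t in (0:ℝ)..T, a₀ t = 0) :
    ∫ t in (0:ℝ)..T, c t * πs t / πn t = σ * T := by
  -- pointwise: c πs / πn = πn'/πn + (a₀ + σ)
  have key : ∀ t, c t * πs t / πn t
      = (c t * πs t - a₀ t * πn t - σ * πn t) / πn t + (a₀ t + σ) := by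
    intro t
    have h := hnz t
    field_simp
    ring
  have hderiv_cont : Continuous (fun t => (c t * πs t - a₀ t * πn t - σ * πn t) / πn t) :=
    (((hc.mul hs).sub (ha.mul hn)).sub (continuous_const.mul hn)).div hn hnz
  have hlog : ∀ t, HasDerivAt (fun s => Real.log (πn s))
      ((c t * πs t - a₀ t * πn t - σ * πn t) / πn t) t :=
    fun t => (hode t).log (hnz t)
  have hftc : ∫ t in (0:ℝ)..T, (c t * πs t - a₀ t * πn t - σ * πn t) / πn t
      = Real.log (πn T) - Real.log (πn 0) :=
    integral_eq_sub_of_hasDerivAt (fun t _ => hlog t) (hderiv_cont.intervalIntegrable _ _)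
  have hi1 : IntervalIntegrable
      (fun t => (c t * πs t - a₀ t * πn t - σ * πn t) / πn t) MeasureTheory.volume 0 T :=
    hderiv_cont.intervalIntegrable _ _
  have hi2 : IntervalIntegrable (fun t => a₀ t + σ) MeasureTheory.volume 0 T :=
    (ha.add continuous_const).intervalIntegrable _ _
  have hia : IntervalIntegrable a₀ MeasureTheory.volume 0 T := ha.intervalIntegrable _ _
  have hic : IntervalIntegrable (fun _ : ℝ => σ) MeasureTheory.volume 0 T :=
    continuous_const.intervalIntegrable _ _
  calc ∫ t in (0:ℝ)..T, c t * πs t / πn t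
      = ∫ t in (0:ℝ)..T, ((c t * πs t - a₀ t * πn t - σ * πn t) / πn t + (a₀ t + σ)) := by
        refine integral_congr ?_
        intro t _
        exact key t
    _ = (∫ t in (0:ℝ)..T, (c t * πs t - a₀ t * πn t - σ * πn t) / πn t)
          + ∫ t in (0:ℝ)..T, (a₀ t + σ) := integral_add hi1 hi2
    _ = (Real.log (πn T) - Real.log (πn 0))
          + ((∫ t in (0:ℝ)..T, a₀ t) + ∫ _ in (0:ℝ)..T, σ) := by
        rw [hftc, integral_add hia hic]
    _ = σ * T := by
        rw [hper, hmean, integral_const]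
        simp only [sub_self, zero_add, sub_zero, smul_eq_mul]
        ring

/-- Period integral of the closed-form limit slow rate `α∞ = -a₀ - K₀ + c πs / (2 πn)`
(with `hₓ/h = πs/πn`): it equals `(σ/2 - K₀) T`. -/
theorem slowRate_integral (T σ K₀ : ℝ) (a₀ c πs πn α : ℝ → ℝ)
    (ha : Continuous a₀) (hc : Continuous c) (hs : Continuous πs) (hn : Continuous πn)
    (hode : ∀ t, HasDerivAt πn (c t * πs t - a₀ t * πn t - σ * πn t) t)
    (hnz : ∀ t, πn t ≠ 0) (hper : πn T = πn 0)
    (hmean : ∫ t in (0:ℝ)..T, a₀ t = 0)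
    (hα : ∀ t, α t = -a₀ t - K₀ + c t * πs t / (2 * πn t)) :
    ∫ t in (0:ℝ)..T, α t = (σ / 2 - K₀) * T := by
  have hgain := liftUpGain_integral T σ a₀ c πs πn ha hc hs hn hode hnz hper hmean
  have hq : Continuous (fun t => c t * πs t / πn t) := (hc.mul hs).div hn hnz
  have hia : IntervalIntegrable (fun t => -a₀ t - K₀) MeasureTheory.volume 0 T :=
    (ha.neg.sub continuous_const).intervalIntegrable _ _
  have hiq : IntervalIntegrable (fun t => (1/2 : ℝ) * (c t * πs t / πn t))
      MeasureTheory.volume 0 T := (continuous_const.mul hq).intervalIntegrable _ _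
  have hia0 : IntervalIntegrable (fun t => -a₀ t) MeasureTheory.volume 0 T :=
    ha.neg.intervalIntegrable _ _
  have hiK : IntervalIntegrable (fun _ : ℝ => K₀) MeasureTheory.volume 0 T :=
    continuous_const.intervalIntegrable _ _
  calc ∫ t in (0:ℝ)..T, α t
      = ∫ t in (0:ℝ)..T, ((-a₀ t - K₀) + (1/2 : ℝ) * (c t * πs t / πn t)) := by
        refine integral_congr ?_
        intro t _
        have h := hnz t
        rw [hα t]
        field_simp
        try ring
    _ = (∫ t in (0:ℝ)..T, (-a₀ t - K₀)) + ∫ t in (0:ℝ)..T, (1/2 : ℝ) * (c t * πs t / πn t) :=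
        integral_add hia hiq
    _ = ((∫ t in (0:ℝ)..T, -a₀ t) - ∫ _ in (0:ℝ)..T, K₀)
          + (1/2 : ℝ) * ∫ t in (0:ℝ)..T, c t * πs t / πn t := by
        rw [integral_sub hia0 hiK, integral_const_mul]
    _ = (σ / 2 - K₀) * T := by
        rw [integral_neg, hmean, integral_const, hgain]
        simp only [neg_zero, sub_zero, smul_eq_mul, zero_sub]
        ring_nf

/-- At the design point `K₀ = σ` the limit slow mode decays at mean rate `K₀/2`:
`∫₀ᵀ α∞ = -K₀ T / 2`. -/
theorem slowRate_integral_design (T K₀ : ℝ) (a₀ c πs πn α : ℝ → ℝ)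
    (ha : Continuous a₀) (hc : Continuous c) (hs : Continuous πs) (hn : Continuous πn)
    (hode : ∀ t, HasDerivAt πn (c t * πs t - a₀ t * πn t - K₀ * πn t) t)
    (hnz : ∀ t, πn t ≠ 0) (hper : πn T = πn 0)
    (hmean : ∫ t in (0:ℝ)..T, a₀ t = 0)
    (hα : ∀ t, α t = -a₀ t - K₀ + c t * πs t / (2 * πn t)) :
    ∫ t in (0:ℝ)..T, α t = -(K₀ * T) / 2 := by
  have h := slowRate_integral T K₀ K₀ a₀ c πs πn α ha hc hs hn hode hnz hper hmean hα
  rw [h]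
  ring

end Summit.AnomalousDissipation.AnomalousDissipation.Theorems
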